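import Summits.Ventures.QEC.Expanders.BiregularExpanderExistence
import Literature.InformationTheory.QuantumCodes.QuantumExpanderThresholdMinMax
import Literature.InformationTheory.QuantumCodes.QuantumExpanderLTZTheorem2
import Literature.InformationTheory.QuantumCodes.QuantumExpanderZSector
import Summits.Ventures.QEC.Expanders.QuantumExpanderDecoderRadiusProjection
import HarnessLib

/-!
# An explicit-size family of quantum expander codes with a decoding threshold (unconditional, non-vacuous)

Venture QEC (`Summits/Ventures/QEC`), item 04.EXIST, third file: the tree's quantum-expander theorems
(`Literature/InformationTheory/QuantumCodes/QuantumExpander*`: LTZ15 Thm 2, FGL18 Thm 1 — all about a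
HYPOTHETICAL biregular expander `G`) combined with the existence of exactly-biregular two-sided lossless expanders
of every size (`exists_biregular_expander_fgl18` / `_ltz15`, random lifts). Results, for all degrees
`Δ_A, Δ_B ≥ 9` (resp. `≥ 7`):

* `exists_ssf_threshold_family` — there are `γ, δ, p₀ > 0` and `C, C' > 0` such that for EVERY `n` some
  `(Δ_A, Δ_B)`-biregular `(γ,δ,γ,δ)`-expander `G_n` on `Δ_B n + Δ_A n` vertices exists and, for ITS quantum expander
  code `Q_{G_n}` (`N = (Δ_B n)² + (Δ_A n)²` qubits), every small-set-flip decoder (Algorithm 1, any tie-breaking)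
  under every locally stochastic `X`-error of parameter `p < p₀` fails with total weight `≤ C N (p/p₀)^{C'√N}` —
  FGL18 Theorem 1 as an unconditional statement about an explicit-size infinite family;
* `exists_ssf_radius_family` — likewise with LTZ15 Theorem 2's adversarial radius
  `min(γ n_A, γ n_B)/(3(1 + max(Δ_A,Δ_B)))`.

All statements PROVED (standard axioms); no named facts; instantiation only (the mathematics is in the cited
files). Words of record (qec-lead block 68 (2)(c)): no novelty claim on the mathematics.
-/

namespace Summit.Ventures.QEC.Expanders

open Finset Matrix Literature.InformationTheory.QuantumCodes

open Classical in
/-- **A threshold for an explicit-size family (FGL18 Thm 1 ∘ existence of expanders)**: for `Δ_A, Δ_B ≥ 9`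
there are `γ, δ, p₀, C' > 0` and `C` such that for every `n` some `(Δ_A,Δ_B)`-biregular `(γ,δ,γ,δ)`-expanding
`H : Matrix (Fin Δ_A × Fin n) (Fin Δ_B × Fin n) (ZMod 2)` exists whose quantum expander code has, for EVERY
small-set-flip decoder (`κ = 0`) and every locally stochastic `X`-error weight of parameter `0 ≤ p < p₀`, total
failure weight `≤ C (n_A² + n_B²) (p/p₀)^{C'√(n_A² + n_B²)}` (`n_A = Δ_B n`, `n_B = Δ_A n`).
[cite: FawziGrospellierLeverrier2018, Thm 1 (§1, arXiv v2 p0004) with Thm 4 / Def 10 remark (existence, p0011)] -/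
theorem exists_ssf_threshold_family (dA dB : ℕ) (hA : 9 ≤ dA) (hB : 9 ≤ dB) :
    ∃ (γ δ p₀ C C' : ℝ), 0 < γ ∧ 0 < δ ∧ 0 < p₀ ∧ 0 < C' ∧
      ∀ n : ℕ, ∃ H : Matrix (Fin dA × Fin n) (Fin dB × Fin n) (ZMod 2),
        IsBiregular H dA dB ∧ IsLeftRightExpanding H dA dB γ δ γ δ ∧
        ∀ D : Decoder ((Fin dB × Fin n) × (Fin dA × Fin n) → ZMod 2)
            (((Fin dB × Fin n) × (Fin dB × Fin n)) ⊕ ((Fin dA × Fin n) × (Fin dA × Fin n)) → ZMod 2),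
          IsSSFDecoder 0 (expanderHX H) (expanderHZ H) D →
          ∀ (p : ℝ) (μ : Finset (((Fin dB × Fin n) × (Fin dB × Fin n)) ⊕ ((Fin dA × Fin n) × (Fin dA × Fin n))) → ℝ),
            0 ≤ p → p < p₀ → IsLocallyStochastic μ p →
            (∑ E ∈ univ.filter (fun E => ¬ D.Corrects (fun x => expanderHX H *ᵥ x)
                (rowSpace (expanderHZ H) : Set _) (flipVec E)), μ E) ≤
              C * ((Fintype.card (Fin dB × Fin n) : ℝ) ^ 2 + (Fintype.card (Fin dA × Fin n) : ℝ) ^ 2) *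
                (p / p₀) ^ (C' * Real.sqrt ((Fintype.card (Fin dB × Fin n) : ℝ) ^ 2 +
                  (Fintype.card (Fin dA × Fin n) : ℝ) ^ 2)) := by
  obtain ⟨γ, δ, hγ, hδ, hβ, hfam⟩ := exists_biregular_expander_fgl18 dA dB hA hB
  have hdA : 0 < dA := by omega
  have hdB : 0 < dB := by omega
  obtain ⟨p₀, C, C', hp₀, hC', hmain⟩ :=
    QuantumExpander.FGL18_theorem1_holds dA dB γ δ γ δ hdA hdB hγ hδ hγ hδ hβ
  refine ⟨γ, δ, p₀, C, C', hγ, hδ, hp₀, hC', fun n => ?_⟩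
  obtain ⟨H, hreg, hexp⟩ := hfam n
  exact ⟨H, hreg, hexp, fun D hD p μ hp0 hpp₀ hμ =>
    hmain (Fin dB × Fin n) (Fin dA × Fin n) H hreg hexp D hD p μ hp0 hpp₀ hμ⟩

/-- **An adversarial radius for an explicit-size family (LTZ15 Thm 2 ∘ existence of expanders)**: for
`Δ_A, Δ_B ≥ 7` there are `γ > 0`, `0 < δ < 1/6` such that for every `n` some `(Δ_A,Δ_B)`-biregular
`(γ,δ,γ,δ)`-expanding `H` exists whose quantum expander code's small-set-flip decoders (Algorithm 1, any
tie-breaking) correct EVERY `X`-error of weight `< min(γ n_A, γ n_B)/(3(1 + max(Δ_A,Δ_B)))`.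
[cite: LeverrierTillichZemor2015, Thm 2 (arXiv v1 p0006) with the remark after it (existence by random choice)] -/
theorem exists_ssf_radius_family (dA dB : ℕ) (hA : 7 ≤ dA) (hB : 7 ≤ dB) :
    ∃ (γ δ : ℝ), 0 < γ ∧ 0 < δ ∧ δ < 1 / 6 ∧
      ∀ n : ℕ, ∃ H : Matrix (Fin dA × Fin n) (Fin dB × Fin n) (ZMod 2),
        IsBiregular H dA dB ∧ IsLeftRightExpanding H dA dB γ δ γ δ ∧
        ∀ D : Decoder ((Fin dB × Fin n) × (Fin dA × Fin n) → ZMod 2)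
            (((Fin dB × Fin n) × (Fin dB × Fin n)) ⊕ ((Fin dA × Fin n) × (Fin dA × Fin n)) → ZMod 2),
          IsSSFDecoder 0 (expanderHX H) (expanderHZ H) D →
          ∀ e : ((Fin dB × Fin n) × (Fin dB × Fin n)) ⊕ ((Fin dA × Fin n) × (Fin dA × Fin n)) → ZMod 2,
            (hammingNorm e : ℝ) <
                1 / (3 * (1 + (max dA dB : ℕ))) *
                  min (γ * Fintype.card (Fin dB × Fin n)) (γ * Fintype.card (Fin dA × Fin n)) →
            D.Corrects (fun x => expanderHX H *ᵥ x) (rowSpace (expanderHZ H) : Set _) e := by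
  obtain ⟨γ, δ, hγ, hδ, hδ6, hfam⟩ := exists_biregular_expander_ltz15 dA dB hA hB
  have hdA : 0 < dA := by omega
  have hdB : 0 < dB := by omega
  refine ⟨γ, δ, hγ, hδ, hδ6, fun n => ?_⟩
  obtain ⟨H, hreg, hexp⟩ := hfam n
  exact ⟨H, hreg, hexp, fun D hD e he =>
    QuantumExpander.ltz15_theorem2_max H hreg hexp hdA hdB hδ hδ6 hδ hδ6 D hD e he⟩

/-! ### Appended (qec-type-04 g4, same session): the parameters of the family together with both decoder
guarantees — one declaration for the census / FINDINGS rows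

For `Δ_A, Δ_B ≥ 9`: constants `γ, δ, p₀, C' > 0`, `C`, and for EVERY `n` an exactly `(Δ_A,Δ_B)`-biregular
`(γ,δ,γ,δ)`-expander `G_n` whose quantum expander code `Q_{G_n}` has `N = (Δ_B n)² + (Δ_A n)²` qubits,
`k = N − rk H_X − rk H_Z ≥ (Δ_B n − Δ_A n)²` (LTZ15 §2 eq. (4); constant rate when `Δ_A ≠ Δ_B`), minimum distance
`≥ ⌊γ·min(Δ_B n, Δ_A n)⌋ + 1` (LTZ15 Cor 5; `Θ(√N)`), every small-set-flip decoder corrects every `X`-error of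
weight `< γ·min(Δ_B n, Δ_A n)/(3(1 + max(Δ_A,Δ_B)))` (LTZ15 Thm 2, convention-free form), and every small-set-flip
decoder has local-stochastic failure weight `≤ C N (p/p₀)^{C'√N}` for `p < p₀` (FGL18 Thm 1). -/

open Classical in
/-- **A good quantum-LDPC family with an efficient decoder, machine-checked and unconditional** (parameters +
adversarial radius + threshold, for every size): for `Δ_A, Δ_B ≥ 9` there are `γ, δ, p₀, C' > 0` and `C` such
that for EVERY `n` some exactly `(Δ_A,Δ_B)`-biregular `(γ,δ,γ,δ)`-expanding `H` exists with: `N = n_A² + n_B²`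
qubits (`n_A = Δ_B n`, `n_B = Δ_A n`); `N − rk H_X − rk H_Z ≥ (n_A − n_B)²` logical qubits; quantum minimum distance
`≥ ⌊min(γ n_A, γ n_B)⌋ + 1`; every small-set-flip decoder (`κ = 0`, any tie-breaking) corrects every `X`-error of
weight `< min(γ n_A, γ n_B)/(3(1 + max(Δ_A,Δ_B)))`; and every such decoder has total local-stochastic failure
weight `≤ C (n_A² + n_B²) (p/p₀)^{C'√(n_A² + n_B²)}` whenever `0 ≤ p < p₀`. (Packaging of
`exists_biregular_expander`, `QuantumExpander.LTZ15_parameters`, `QuantumExpander.floor_succ_le_cssMinDist`,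
`QuantumExpander.ltz15_theorem2_max`, `QuantumExpander.FGL18_theorem1_holds`; `δ = 2/17`.)
[cite: LeverrierTillichZemor2015, Thm 1 (ii)-(iii), §2 eq. (4), Cor 5, Thm 2 (arXiv v1 p0005-p0008)] [cite: FawziGrospellierLeverrier2018, Thm 1 (§1, arXiv v2 p0004)] -/
theorem exists_good_quantumExpander_family (dA dB : ℕ) (hA : 9 ≤ dA) (hB : 9 ≤ dB) :
    ∃ (γ δ p₀ C C' : ℝ), 0 < γ ∧ 0 < δ ∧ 0 < p₀ ∧ 0 < C' ∧
      ∀ n : ℕ, ∃ H : Matrix (Fin dA × Fin n) (Fin dB × Fin n) (ZMod 2),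
        IsBiregular H dA dB ∧ IsLeftRightExpanding H dA dB γ δ γ δ ∧
        Fintype.card (((Fin dB × Fin n) × (Fin dB × Fin n)) ⊕ ((Fin dA × Fin n) × (Fin dA × Fin n)))
            = Fintype.card (Fin dB × Fin n) ^ 2 + Fintype.card (Fin dA × Fin n) ^ 2 ∧
        ((Fintype.card (Fin dB × Fin n) : ℤ) - Fintype.card (Fin dA × Fin n)) ^ 2
            ≤ (Fintype.card (((Fin dB × Fin n) × (Fin dB × Fin n)) ⊕ ((Fin dA × Fin n) × (Fin dA × Fin n))) : ℤ)
              - (expanderHX H).rank - (expanderHZ H).rank ∧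
        ((⌊min (γ * Fintype.card (Fin dB × Fin n)) (γ * Fintype.card (Fin dA × Fin n))⌋₊ + 1 : ℕ) : ℕ∞)
            ≤ cssMinDist (expanderHX H) (expanderHZ H) ∧
        (∀ D : Decoder ((Fin dB × Fin n) × (Fin dA × Fin n) → ZMod 2)
            (((Fin dB × Fin n) × (Fin dB × Fin n)) ⊕ ((Fin dA × Fin n) × (Fin dA × Fin n)) → ZMod 2),
          IsSSFDecoder 0 (expanderHX H) (expanderHZ H) D →
          ∀ e : ((Fin dB × Fin n) × (Fin dB × Fin n)) ⊕ ((Fin dA × Fin n) × (Fin dA × Fin n)) → ZMod 2,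
            (hammingNorm e : ℝ) <
                1 / (3 * (1 + (max dA dB : ℕ))) *
                  min (γ * Fintype.card (Fin dB × Fin n)) (γ * Fintype.card (Fin dA × Fin n)) →
            D.Corrects (fun x => expanderHX H *ᵥ x) (rowSpace (expanderHZ H) : Set _) e) ∧
        (∀ D : Decoder ((Fin dB × Fin n) × (Fin dA × Fin n) → ZMod 2)
            (((Fin dB × Fin n) × (Fin dB × Fin n)) ⊕ ((Fin dA × Fin n) × (Fin dA × Fin n)) → ZMod 2),
          IsSSFDecoder 0 (expanderHX H) (expanderHZ H) D →
          ∀ (p : ℝ) (μ : Finset (((Fin dB × Fin n) × (Fin dB × Fin n)) ⊕ ((Fin dA × Fin n) × (Fin dA × Fin n))) → ℝ),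
            0 ≤ p → p < p₀ → IsLocallyStochastic μ p →
            (∑ E ∈ univ.filter (fun E => ¬ D.Corrects (fun x => expanderHX H *ᵥ x)
                (rowSpace (expanderHZ H) : Set _) (flipVec E)), μ E) ≤
              C * ((Fintype.card (Fin dB × Fin n) : ℝ) ^ 2 + (Fintype.card (Fin dA × Fin n) : ℝ) ^ 2) *
                (p / p₀) ^ (C' * Real.sqrt ((Fintype.card (Fin dB × Fin n) : ℝ) ^ 2 +
                  (Fintype.card (Fin dA × Fin n) : ℝ) ^ 2))) := by
  obtain ⟨γ, δ, hγ, hδ, hβ, hfam⟩ := exists_biregular_expander_fgl18 dA dB hA hB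
  have hdA : 0 < dA := by omega
  have hdB : 0 < dB := by omega
  obtain ⟨p₀, C, C', hp₀, hC', hmain⟩ :=
    QuantumExpander.FGL18_theorem1_holds dA dB γ δ γ δ hdA hdB hγ hδ hγ hδ hβ
  -- `δ < 1/2` and `δ < 1/6` from `β₀ > 0` are not available abstractly; we re-derive `δ < 1/8` from `β₀ > 0`
  have hδ8 : δ < 1 / 8 := by
    have h := (QuantumExpander.betaZero_pos_iff hdA hdB δ δ).1 hβ
    nlinarith [sq_nonneg (δ - δ)]
  have hδ6 : δ < 1 / 6 := by linarith
  have hδ2 : δ < 1 / 2 := by linarith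
  refine ⟨γ, δ, p₀, C, C', hγ, hδ, hp₀, hC', fun n => ?_⟩
  obtain ⟨H, hreg, hexp⟩ := hfam n
  obtain ⟨hcard, hdim, _⟩ := QuantumExpander.LTZ15_parameters H
  refine ⟨H, hreg, hexp, hcard, hdim, ?_, ?_, ?_⟩
  · exact QuantumExpander.floor_succ_le_cssMinDist H (fun a => (hreg.1 a).le) (fun b => (hreg.2 b).le)
      hdA hdB hexp hδ2 hδ2
  · intro D hD e he
    exact QuantumExpander.ltz15_theorem2_max H hreg hexp hdA hdB hδ hδ6 hδ hδ6 D hD e he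
  · intro D hD p μ hp0 hpp₀ hμ
    exact hmain (Fin dB × Fin n) (Fin dA × Fin n) H hreg hexp D hD p μ hp0 hpp₀ hμ

/-! ### Appended (qec-type-04 g5): the family under i.i.d. depolarizing noise, both sectors decoded

`QuantumExpanderZSector.lean` (g5) gives FGL18 Thm 1 for the `Z`-sector of `Q_G` in its own coordinates and, through
type-09's marginal union bound `CSSCode.depolarizingFailureProb_le`, the depolarizing corollary
`QuantumExpander.fgl18_theorem1_depolarizing`. Composed with `exists_biregular_expander_fgl18` it yields a depolarizing
threshold for an explicit-size family — the "threshold of the CODE" (both error types) that the rows above state for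
one sector only. -/

open Classical in
/-- **A depolarizing threshold for an explicit-size quantum expander family (sector-wise small-set-flip decoding)**:
for `Δ_A, Δ_B ≥ 9` there are `γ, δ, p₀, C' > 0` and `C` such that for EVERY `n` some exactly `(Δ_A,Δ_B)`-biregular
`(γ,δ,γ,δ)`-expanding `H` exists whose quantum expander code, presented as the CSS code
`CSSCode.ofMatrices (expanderHX H) (expanderHZ H)` and decoded sector-wise by ANY pair of small-set-flip decoders
(`κ = 0`, any tie-breaking: `D₁` with syndromes `expanderHZ H` and flips in the rows of `expanderHX H`, `D₂` the
other way round), has i.i.d.-depolarizing failure probability `≤ 2·C·N·((2p/3)/p₀)^{C'√N}` for every rate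
`0 ≤ p ≤ 1` with `2p/3 < p₀` (`N = n_A² + n_B²`, `n_A = Δ_B n`, `n_B = Δ_A n`) — a depolarizing threshold `(3/2)·p₀`.
Union bound over the two sectors; no statement about correlation-aware decoding; no novelty claim.
[cite: FawziGrospellierLeverrier2018, Thm 1 (§1, arXiv v2 p0004), §2.3 (X- and Z-decoding algorithms, p0008 L1-6), §2.4 (remark after Def 7: depolarizing marginals 2p/3, p0010 L23)] -/
theorem exists_depolarizing_threshold_family (dA dB : ℕ) (hA : 9 ≤ dA) (hB : 9 ≤ dB) :
    ∃ (γ δ p₀ C C' : ℝ), 0 < γ ∧ 0 < δ ∧ 0 < p₀ ∧ 0 < C' ∧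
      ∀ n : ℕ, ∃ H : Matrix (Fin dA × Fin n) (Fin dB × Fin n) (ZMod 2),
        IsBiregular H dA dB ∧ IsLeftRightExpanding H dA dB γ δ γ δ ∧
        ∀ (D₁ : Decoder ((Fin dA × Fin n) × (Fin dB × Fin n) → ZMod 2)
            (((Fin dB × Fin n) × (Fin dB × Fin n)) ⊕ ((Fin dA × Fin n) × (Fin dA × Fin n)) → ZMod 2))
          (D₂ : Decoder ((Fin dB × Fin n) × (Fin dA × Fin n) → ZMod 2)
            (((Fin dB × Fin n) × (Fin dB × Fin n)) ⊕ ((Fin dA × Fin n) × (Fin dA × Fin n)) → ZMod 2)),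
          IsSSFDecoder 0 (expanderHZ H) (expanderHX H) D₁ →
          IsSSFDecoder 0 (expanderHX H) (expanderHZ H) D₂ →
          ∀ p : ℝ, 0 ≤ p → p ≤ 1 → 2 * p / 3 < p₀ →
            (CSSCode.ofMatrices (expanderHX H) (expanderHZ H)
                (expanderHX_mul_expanderHZ_transpose H)).depolarizingFailureProb D₁ D₂ p ≤
              2 * (C * ((Fintype.card (Fin dB × Fin n) : ℝ) ^ 2 + (Fintype.card (Fin dA × Fin n) : ℝ) ^ 2) *
                ((2 * p / 3) / p₀) ^ (C' * Real.sqrt ((Fintype.card (Fin dB × Fin n) : ℝ) ^ 2 +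
                  (Fintype.card (Fin dA × Fin n) : ℝ) ^ 2))) := by
  obtain ⟨γ, δ, hγ, hδ, hβ, hfam⟩ := exists_biregular_expander_fgl18 dA dB hA hB
  have hdA : 0 < dA := by omega
  have hdB : 0 < dB := by omega
  obtain ⟨p₀, C, C', hp₀, hC', hmain⟩ :=
    QuantumExpander.fgl18_theorem1_depolarizing dA dB γ δ γ δ hdA hdB hγ hδ hγ hδ hβ
  have hκ : (0 : ℝ) ≤ betaZero (min dA dB) (max dA dB) δ δ * ((max dA dB : ℕ) : ℝ) :=
    mul_nonneg ((QuantumExpander.betaZero_minmax_pos_iff hdA hdB δ δ).2 hβ).le (Nat.cast_nonneg _)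
  refine ⟨γ, δ, p₀, C, C', hγ, hδ, hp₀, hC', fun n => ?_⟩
  obtain ⟨H, hreg, hexp⟩ := hfam n
  exact ⟨H, hreg, hexp, fun D₁ D₂ hD₁ hD₂ p hp0 hp1 hp =>
    hmain (Fin dB × Fin n) (Fin dA × Fin n) H hreg hexp 0 hκ D₁ D₂ hD₁ hD₂ p hp0 hp1 hp⟩

/-! ### Appended (qec-type-04 g5): the adversarial radius for BOTH sectors of the family

`QuantumExpanderZSector.lean` (appended `QuantumExpander.ltz15_theorem2_zsector`) gives LTZ15 Thm 2 for the `Z`-sector of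
`Q_G` in its own coordinates; with `exists_biregular_expander_ltz15` this is the two-sector form of `exists_ssf_radius_family`. -/

/-- **An adversarial radius for BOTH sectors of an explicit-size family (LTZ15 Thm 2 ∘ existence of expanders)**: for
`Δ_A, Δ_B ≥ 7` there are `γ > 0`, `0 < δ < 1/6` such that for every `n` some `(Δ_A,Δ_B)`-biregular `(γ,δ,γ,δ)`-expanding
`H` exists for whose quantum expander code EVERY small-set-flip decoder of EITHER sector (Algorithm 1, any tie-breaking:
`D_X` with syndromes `expanderHX H` / flips in the rows of `expanderHZ H`, `D_Z` the other way round) corrects every error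
of its type of weight `< min(γ n_A, γ n_B)/(3(1 + max(Δ_A,Δ_B)))`. [cite: LeverrierTillichZemor2015, Thm 2 (arXiv v1 p0006) with §2 ("exchanging the roles of A and B") and the remark after Thm 2 (existence by random choice)] -/
theorem exists_ssf_radius_family_both (dA dB : ℕ) (hA : 7 ≤ dA) (hB : 7 ≤ dB) :
    ∃ (γ δ : ℝ), 0 < γ ∧ 0 < δ ∧ δ < 1 / 6 ∧
      ∀ n : ℕ, ∃ H : Matrix (Fin dA × Fin n) (Fin dB × Fin n) (ZMod 2),
        IsBiregular H dA dB ∧ IsLeftRightExpanding H dA dB γ δ γ δ ∧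
        (∀ D : Decoder ((Fin dB × Fin n) × (Fin dA × Fin n) → ZMod 2)
            (((Fin dB × Fin n) × (Fin dB × Fin n)) ⊕ ((Fin dA × Fin n) × (Fin dA × Fin n)) → ZMod 2),
          IsSSFDecoder 0 (expanderHX H) (expanderHZ H) D →
          ∀ e : ((Fin dB × Fin n) × (Fin dB × Fin n)) ⊕ ((Fin dA × Fin n) × (Fin dA × Fin n)) → ZMod 2,
            (hammingNorm e : ℝ) <
                1 / (3 * (1 + (max dA dB : ℕ))) *
                  min (γ * Fintype.card (Fin dB × Fin n)) (γ * Fintype.card (Fin dA × Fin n)) →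
            D.Corrects (fun x => expanderHX H *ᵥ x) (rowSpace (expanderHZ H) : Set _) e) ∧
        (∀ D : Decoder ((Fin dA × Fin n) × (Fin dB × Fin n) → ZMod 2)
            (((Fin dB × Fin n) × (Fin dB × Fin n)) ⊕ ((Fin dA × Fin n) × (Fin dA × Fin n)) → ZMod 2),
          IsSSFDecoder 0 (expanderHZ H) (expanderHX H) D →
          ∀ e : ((Fin dB × Fin n) × (Fin dB × Fin n)) ⊕ ((Fin dA × Fin n) × (Fin dA × Fin n)) → ZMod 2,
            (hammingNorm e : ℝ) <
                1 / (3 * (1 + (max dA dB : ℕ))) *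
                  min (γ * Fintype.card (Fin dB × Fin n)) (γ * Fintype.card (Fin dA × Fin n)) →
            D.Corrects (fun x => expanderHZ H *ᵥ x) (rowSpace (expanderHX H) : Set _) e) := by
  obtain ⟨γ, δ, hγ, hδ, hδ6, hfam⟩ := exists_biregular_expander_ltz15 dA dB hA hB
  have hdA : 0 < dA := by omega
  have hdB : 0 < dB := by omega
  refine ⟨γ, δ, hγ, hδ, hδ6, fun n => ?_⟩
  obtain ⟨H, hreg, hexp⟩ := hfam n
  exact ⟨H, hreg, hexp,
    fun D hD e he => QuantumExpander.ltz15_theorem2_max H hreg hexp hdA hdB hδ hδ6 hδ hδ6 D hD e he,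
    fun D hD e he => QuantumExpander.ltz15_theorem2_zsector H hreg hexp hdA hdB hδ hδ6 hδ hδ6 D hD e he⟩

/-! ### Appended (qec-type-04 g7, PARTITION item 149 «04.RAD3», R2): the tripled adversarial radius for the family

With `ssfDecoder_corrects_of_weight_le` / `_zsector` (`QuantumExpanderDecoderRadiusProjection.lean`: along any small-set-flip
run the projections `E_A²`, `π₁(E∩B²)` grow by at most one column / row per step, so counting steps instead of weights gives
the radius `min(γ_A n_A, γ_B n_B)/(1 + max Δ)` for every threshold `κ ≤ 1/3`), the family of `exists_ssf_radius_family_both`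
corrects, in both sectors, every error of weight `≤ min(γ n_A, γ n_B)/(1 + max(Δ_A,Δ_B))` — three times the radius stated
there — and, for every target `t`, all members beyond an explicit size correct EVERY error of weight `≤ t` (non-vacuity).
HONEST FRAMING: OURS (not a printed radius); existence form. -/

/-- **An adversarial radius `min(γ n_A, γ n_B)/(1 + max(Δ_A,Δ_B))` for BOTH sectors of an explicit-size quantum expander
family, every small-set-flip threshold `κ ≤ 1/3`**: for `Δ_A, Δ_B ≥ 7` there are `γ > 0` and `0 < δ < 1/6` such that for
every `n` some `(Δ_A,Δ_B)`-biregular `(γ,δ,γ,δ)`-expander `H_n` (on `Δ_B n + Δ_A n` vertices) has: every small-set-flip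
decoder with threshold `κ ≤ 1/3` (Algorithm 1 = `κ = 0` included, any tie-breaking) for the `X`-sector (syndromes
`expanderHX`, flips in the rows of `expanderHZ`) and every one for the `Z`-sector (roles exchanged) corrects every error `e`
of its type with `(1 + max(Δ_A,Δ_B))·|e| ≤ min(γ·|Fin Δ_B × Fin n|, γ·|Fin Δ_A × Fin n|)`. STATUS: OURS — three times the
radius of `exists_ssf_radius_family_both` (LTZ15 Thm 2's `w₀` with `max Δ`), non-strict, all `κ ≤ 1/3`; by the projection
invariant. [cite: LeverrierTillichZemor2015, Thm 2 (arXiv v1 p0006 L15-22) and Lemma 10 (p0009 L40-75)] -/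
theorem exists_ssf_radius_family_both_three (dA dB : ℕ) (hA : 7 ≤ dA) (hB : 7 ≤ dB) :
    ∃ (γ δ : ℝ), 0 < γ ∧ 0 < δ ∧ δ < 1 / 6 ∧
      ∀ n : ℕ, ∃ H : Matrix (Fin dA × Fin n) (Fin dB × Fin n) (ZMod 2),
        IsBiregular H dA dB ∧ IsLeftRightExpanding H dA dB γ δ γ δ ∧
        (∀ κ : ℝ, κ ≤ 1 / 3 →
          ∀ D : Decoder ((Fin dB × Fin n) × (Fin dA × Fin n) → ZMod 2)
            (((Fin dB × Fin n) × (Fin dB × Fin n)) ⊕ ((Fin dA × Fin n) × (Fin dA × Fin n)) → ZMod 2),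
          IsSSFDecoder κ (expanderHX H) (expanderHZ H) D →
          ∀ e : ((Fin dB × Fin n) × (Fin dB × Fin n)) ⊕ ((Fin dA × Fin n) × (Fin dA × Fin n)) → ZMod 2,
            (1 + ((max dA dB : ℕ) : ℝ)) * hammingNorm e ≤
                min (γ * Fintype.card (Fin dB × Fin n)) (γ * Fintype.card (Fin dA × Fin n)) →
            D.Corrects (fun x => expanderHX H *ᵥ x) (rowSpace (expanderHZ H) : Set _) e) ∧
        (∀ κ : ℝ, κ ≤ 1 / 3 →
          ∀ D : Decoder ((Fin dA × Fin n) × (Fin dB × Fin n) → ZMod 2)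
            (((Fin dB × Fin n) × (Fin dB × Fin n)) ⊕ ((Fin dA × Fin n) × (Fin dA × Fin n)) → ZMod 2),
          IsSSFDecoder κ (expanderHZ H) (expanderHX H) D →
          ∀ e : ((Fin dB × Fin n) × (Fin dB × Fin n)) ⊕ ((Fin dA × Fin n) × (Fin dA × Fin n)) → ZMod 2,
            (1 + ((max dA dB : ℕ) : ℝ)) * hammingNorm e ≤
                min (γ * Fintype.card (Fin dB × Fin n)) (γ * Fintype.card (Fin dA × Fin n)) →
            D.Corrects (fun x => expanderHZ H *ᵥ x) (rowSpace (expanderHX H) : Set _) e) := by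
  obtain ⟨γ, δ, hγ, hδ, hδ6, hfam⟩ := exists_biregular_expander_ltz15 dA dB hA hB
  have hdA : 0 < dA := by omega
  have hdB : 0 < dB := by omega
  refine ⟨γ, δ, hγ, hδ, hδ6, fun n => ?_⟩
  obtain ⟨H, hreg, hexp⟩ := hfam n
  exact ⟨H, hreg, hexp,
    fun κ hκ D hD e he => ssfDecoder_corrects_of_weight_le H hreg hexp hdA hdB hδ.le hδ6 hδ.le hδ6 hκ D hD e he,
    fun κ hκ D hD e he => ssfDecoder_corrects_of_weight_le_zsector H hreg hexp hdA hdB hδ.le hδ6 hδ.le hδ6 hκ D hD e he⟩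

/-- **Non-vacuity of the radius, in the strongest form: every error of weight `≤ t` is corrected beyond an explicit size.**
For `Δ_A, Δ_B ≥ 7` there are `γ > 0`, `0 < δ < 1/6` such that for every target `t : ℕ` and every
`n ≥ (1 + max(Δ_A,Δ_B))·t/(γ·min(Δ_A,Δ_B))`, the `n`-th member `H_n` of the family has: every small-set-flip decoder of
threshold `κ ≤ 1/3` of the `X`-sector of `Q_{H_n}` corrects EVERY error of weight `≤ t` (in particular, with `t ≥ 1`, the
radius of `exists_ssf_radius_family_both_three` admits non-zero errors). STATUS: OURS; instantiation of the previous theorem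
(`|Fin Δ × Fin n| = Δ·n`). [cite: LeverrierTillichZemor2015, Thm 2 (arXiv v1 p0006 L15-22)] -/
theorem exists_ssf_radius_family_corrects_weight_le (dA dB : ℕ) (hA : 7 ≤ dA) (hB : 7 ≤ dB) :
    ∃ (γ δ : ℝ), 0 < γ ∧ 0 < δ ∧ δ < 1 / 6 ∧
      ∀ (t n : ℕ), (1 + ((max dA dB : ℕ) : ℝ)) * t ≤ γ * ((min dA dB : ℕ) : ℝ) * n →
        ∃ H : Matrix (Fin dA × Fin n) (Fin dB × Fin n) (ZMod 2),
        IsBiregular H dA dB ∧ IsLeftRightExpanding H dA dB γ δ γ δ ∧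
        ∀ κ : ℝ, κ ≤ 1 / 3 →
          ∀ D : Decoder ((Fin dB × Fin n) × (Fin dA × Fin n) → ZMod 2)
            (((Fin dB × Fin n) × (Fin dB × Fin n)) ⊕ ((Fin dA × Fin n) × (Fin dA × Fin n)) → ZMod 2),
          IsSSFDecoder κ (expanderHX H) (expanderHZ H) D →
          ∀ e : ((Fin dB × Fin n) × (Fin dB × Fin n)) ⊕ ((Fin dA × Fin n) × (Fin dA × Fin n)) → ZMod 2,
            hammingNorm e ≤ t →
            D.Corrects (fun x => expanderHX H *ᵥ x) (rowSpace (expanderHZ H) : Set _) e := by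
  obtain ⟨γ, δ, hγ, hδ, hδ6, hfam⟩ := exists_ssf_radius_family_both_three dA dB hA hB
  refine ⟨γ, δ, hγ, hδ, hδ6, fun t n hn => ?_⟩
  obtain ⟨H, hreg, hexp, hX, -⟩ := hfam n
  refine ⟨H, hreg, hexp, fun κ hκ D hD e he => hX κ hκ D hD e ?_⟩
  have hcardB : (Fintype.card (Fin dB × Fin n) : ℝ) = (dB : ℝ) * n := by
    rw [Fintype.card_prod, Fintype.card_fin, Fintype.card_fin]; push_cast; ring
  have hcardA : (Fintype.card (Fin dA × Fin n) : ℝ) = (dA : ℝ) * n := by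
    rw [Fintype.card_prod, Fintype.card_fin, Fintype.card_fin]; push_cast; ring
  rw [hcardB, hcardA]
  have hm : (0 : ℝ) ≤ 1 + ((max dA dB : ℕ) : ℝ) := by positivity
  have he' : (hammingNorm e : ℝ) ≤ t := by exact_mod_cast he
  have h1 : (1 + ((max dA dB : ℕ) : ℝ)) * hammingNorm e ≤ (1 + ((max dA dB : ℕ) : ℝ)) * t :=
    mul_le_mul_of_nonneg_left he' hm
  have hminB : ((min dA dB : ℕ) : ℝ) ≤ dB := by exact_mod_cast min_le_right dA dB
  have hminA : ((min dA dB : ℕ) : ℝ) ≤ dA := by exact_mod_cast min_le_left dA dB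
  have hn0 : (0 : ℝ) ≤ n := Nat.cast_nonneg _
  refine h1.trans (hn.trans (le_min ?_ ?_))
  · have := mul_le_mul_of_nonneg_right hminB hn0
    nlinarith
  · have := mul_le_mul_of_nonneg_right hminA hn0
    nlinarith

end Summit.Ventures.QEC.Expanders
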